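import Literature.NumberTheory.LFunctions.Zhang2022.RepairGapPartIIIDoors
import Literature.NumberTheory.LFunctions.Zhang2022.Section15ResidueEstimates
import HarnessLib

/-!
# Zhang (2022), rescue GAP/BED (D-0124 (3)(4)): §15 p. 88 — the residues `ℛ₁ⱼ = M₁ⱼ(1 + O(𝓛⁻⁶))` (surviving form of
# Z22:§15.u059, `j = 1, 2, 3`) under the minimum premise `‖L(1,χ)‖ ≤ 𝓛⁻¹⁵` (node (18.1) inputs; GAP G-31)

Topic `Literature/NumberTheory/LFunctions/Zhang2022` (Landau–Siegel audit tree; verdict-neutral).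
Y. Zhang, *Discrete mean estimates and the Landau–Siegel zero*, arXiv:2211.02515v1 (2022)
[Zhang2022LandauSiegel] — **an unrefereed manuscript under adjudication; nothing in this file asserts or
denies its Theorems 1–2, and nothing here is a claim about Landau–Siegel zeros. The programme SEARCHES and
TYPES; no claim about Landau–Siegel zeros, Theorems 1–2 of arXiv:2211.02515 or a repaired Margin232 until a
kernel theorem says so.**

The §15 residues `ℛ₁ⱼ` (`Typed.Section15B.calR1 c′ χ j`, the residues of the §15 integrand at `s = −βⱼ`) are evaluated in the
tree as `ℛ₁ⱼ = M₁ⱼ(1 + O(𝓛⁻⁶))`, `M₁ⱼ = P₄^{β₃−βⱼ}/((β_{j+1}−βⱼ)(β_{j+2}−βⱼ)L′(1,χ))` (`ResidueValues.calR1_one_rel` /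
`_two_rel` / `_three_rel`), all over ONE eventual set-up `ResidueValues.residue_setup` that gathers every (A)-use of the step:
Lemma 5.7 (`norm_deriv_LFunction_one_ge`), the `ζ`-factor bounds (A-free) and the `L(1−β,χ)` quotient (`L_one_sub_beta_bounds`,
Lemma 5.8). Both doors have minimum-premise twins (`Repair.Gap.norm_deriv_LFunction_one_ge_pow15`,
`Repair.Gap.L_one_sub_beta_bounds_pow15`, file `RepairGapPartIIIDoors`, p585783). This file re-runs the set-up and the three
evaluations VERBATIM with the guard `AssumptionA D χ` replaced by `‖L(1,χ)‖ ≤ 𝓛⁻¹⁵` (SAME constants `4C_L + 12·16Kπ + 32` /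
`… + 28·16Kπ + 32` and thresholds); the (A)-free helpers `zetaFactor_bounds`, `residue_identity15*`, `norm_mul_sub_one_le_rel`
are the tree's. Sibling `RepairGapSection15U06xPremise` assembles u060–u062. Theorems only; no definition, no named fact;
nothing about (A) itself.

## References

* Y. Zhang, arXiv:2211.02515v1 (2022), §15 p. 88; §5 Lemmas 5.7, 5.8. [cite: Zhang2022LandauSiegel, §15 p. 88]
-/

noncomputable section

open Complex Real Filter Topology

namespace Literature.NumberTheory.LFunctions.Zhang2022.ResidueValues

open Skeleton Typed.Section15B

variable (c' : ℝ)

/-- **The eventual regime under the minimum premise** (twin of `ResidueValues.residue_setup`): for all large `D` and every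
real primitive `χ` with `‖L(1,χ)‖ ≤ 𝓛⁻¹⁵`: `𝓛 ≥ 3`, `|c′α𝓛| ≤ 1/14`, `16Kπ + 1 ≤ 𝓛`, `χ ≠ 1`, `|L′(1,χ)| ≥ c` (door 1),
the `ζ`-factor bounds for `0 < |u| ≤ 8α`, and the `L(1−β,χ)` quotient bounds for `α/2 ≤ |β| ≤ 4α` (door 3).
[cite: Zhang2022LandauSiegel, §15 p. 88] -/
theorem residue_setup_pow15 : ∃ K : ℝ, 0 ≤ K ∧ ∃ CL : ℝ, 0 ≤ CL ∧ ∃ c : ℝ, 0 < c ∧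
    ForAllLarge fun D _ χ => ‖χ.LFunction 1‖ ≤ 1 / Real.log D ^ 15 →
      (3 ≤ ell D ∧ |c' * alpha D * ell D| ≤ 1 / 14 ∧ 16 * K * π + 1 ≤ ell D ∧ χ ≠ 1) ∧
      c ≤ ‖deriv χ.LFunction 1‖ ∧
      (∀ u : ℂ, u ≠ 0 → ‖u‖ ≤ 8 * alpha D → riemannZeta (1 + u) ≠ 0 ∧
        ‖u * riemannZeta (1 + u) - 1‖ ≤ K * ‖u‖ ∧ ‖u * riemannZeta (1 + u) - 1‖ ≤ 1 / 2) ∧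
      (∀ β : ℂ, alpha D / 2 ≤ ‖β‖ → ‖β‖ ≤ 4 * alpha D → χ.LFunction (1 - β) ≠ 0 ∧
        ‖χ.LFunction (1 - β) / (-β * deriv χ.LFunction 1) - 1‖ ≤ CL / ell D ^ 6 ∧
          CL / ell D ^ 6 ≤ 1 / 2) := by
  obtain ⟨c, hc, h57⟩ := Repair.Gap.norm_deriv_LFunction_one_ge_pow15
  obtain ⟨r, hr, K, hK, hζ⟩ := zeta_shift_bounds
  obtain ⟨CL, hCL0, hLb⟩ := Repair.Gap.L_one_sub_beta_bounds_pow15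
  obtain ⟨D₀, hall⟩ := h57.and hLb
  refine ⟨K, hK, CL, hCL0, c, hc,
    max D₀ (max (max ⌈Real.exp 3⌉₊ ⌈Real.exp (14 * |c'| * π)⌉₊)
      (max ⌈Real.exp (8 * π / r + 1)⌉₊ ⌈Real.exp (16 * K * π + 1)⌉₊)), fun D _ χ hD hq hp h15 => ?_⟩
  have hD₀ : D₀ ≤ D := le_trans (le_max_left _ _) hD
  have hD1 := le_trans (le_trans (le_max_left _ _) (le_max_right _ _)) hD
  have hD2 := le_trans (le_trans (le_max_left _ _) (le_trans (le_max_right _ _) (le_max_right _ _))) hD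
  have hD3 := le_trans (le_trans (le_max_right _ _) (le_trans (le_max_right _ _) (le_max_right _ _))) hD
  obtain ⟨hL, he⟩ := thresholds c' hD1
  have hℓ : 0 < ell D := by linarith
  have hlogD2 : 8 * π / r + 1 ≤ ell D := by
    have h : Real.exp (8 * π / r + 1) ≤ D := le_trans (Nat.le_ceil _) (by exact_mod_cast hD2)
    exact (Real.le_log_iff_exp_le (lt_of_lt_of_le (Real.exp_pos _) h)).mpr h
  have hlogD3 : 16 * K * π + 1 ≤ ell D := by
    have h : Real.exp (16 * K * π + 1) ≤ D := le_trans (Nat.le_ceil _) (by exact_mod_cast hD3)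
    exact (Real.le_log_iff_exp_le (lt_of_lt_of_le (Real.exp_pos _) h)).mpr h
  have h8α : 8 * alpha D < r := by
    have h1 : alpha D ≤ π / ell D := alpha_le hL
    have h2 : 8 * π / r < ell D := by linarith
    calc 8 * alpha D ≤ 8 * (π / ell D) := by linarith
      _ = (8 * π / r) * (r / ell D) := by field_simp
      _ < ell D * (r / ell D) := by gcongr
      _ = r := by field_simp
  have hχ1 : χ ≠ 1 := by
    have hD1' : D ≠ 1 := by
      rintro rfl; norm_num [ell] at hL
    exact GammaFactor.ne_one_of_isPrimitive hp hD1'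
  obtain ⟨g57, gL⟩ := hall D χ hD₀ hq hp
  refine ⟨⟨hL, he, hlogD3, hχ1⟩, g57 h15, fun u hu0 hu => hζ u hu0 (lt_of_le_of_lt hu h8α), gL h15⟩

/-- **`ℛ₁₁ = M₁₁(1 + O(𝓛⁻⁶))` under the minimum premise** (twin of `ResidueValues.calR1_one_rel`, same constant).
[cite: Zhang2022LandauSiegel, §15 p. 88] -/
theorem calR1_one_rel_pow15 : ∃ C : ℝ, 0 ≤ C ∧ ForAllLarge fun D _ χ => ‖χ.LFunction 1‖ ≤ 1 / Real.log D ^ 15 →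
    ‖calR1 c' χ 1 - ((P4 D : ℝ) : ℂ) ^ (beta3 c' D - beta1 c' D) /
        ((beta2 c' D - beta1 c' D) * (beta3 c' D - beta1 c' D) * deriv χ.LFunction 1)‖ ≤
      C / ell D ^ 6 * ‖((P4 D : ℝ) : ℂ) ^ (beta3 c' D - beta1 c' D) /
        ((beta2 c' D - beta1 c' D) * (beta3 c' D - beta1 c' D) * deriv χ.LFunction 1)‖ := by
  obtain ⟨K, hK, CL, hCL0, c, hc, D₀, hall⟩ := residue_setup_pow15 c'
  refine ⟨4 * CL + 12 * (16 * K * π) + 32, by positivity, D₀, fun D _ χ hD hq hp h15 => ?_⟩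
  obtain ⟨⟨hL, he, hKℓ, hχ1⟩, hcL, hζ, hLb⟩ := hall D χ hD hq hp h15
  clear hall
  have hℓ : 0 < ell D := by linarith
  have hℓ1 : 1 ≤ ell D := by linarith
  have hα := alpha_pos hL
  set L1 : ℂ := deriv χ.LFunction 1 with hL1
  have hN : 0 < ‖L1‖ := lt_of_lt_of_le hc hcL
  have hL0 : L1 ≠ 0 := fun h => by rw [h, norm_zero] at hN; exact lt_irrefl _ hN
  obtain ⟨hβ1l, -, hβ3l⟩ := norm_beta_ge c' hL he
  have hβ1u := norm_beta1_le c' hL he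
  obtain ⟨⟨h21l, h21u⟩, ⟨h31l, h31u⟩, -⟩ := norm_beta_sub c' hL he
  have hβ1ne : beta1 c' D ≠ 0 := fun h => by rw [h, norm_zero] at hβ1l; linarith
  have h21ne : beta2 c' D - beta1 c' D ≠ 0 := fun h => by rw [h, norm_zero] at h21l; linarith
  have h31ne : beta3 c' D - beta1 c' D ≠ 0 := fun h => by rw [h, norm_zero] at h31l; linarith
  have hP := P4_pos hL
  -- the factors
  obtain ⟨-, -, -, tZ1⟩ := zetaFactor_bounds hL hK hKℓ hζ h21ne h21u
  obtain ⟨-, tZu, -, -⟩ := zetaFactor_bounds hL hK hKℓ hζ h21ne h21u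
  have hu1 : ‖-beta1 c' D‖ ≤ 8 * alpha D := by rw [norm_neg]; linarith
  obtain ⟨hζne, -, tZ1inv, -⟩ := zetaFactor_bounds hL hK hKℓ hζ (neg_ne_zero.mpr hβ1ne) hu1
  clear hζ
  have hζne' : riemannZeta (1 - beta1 c' D) ≠ 0 := by rw [sub_eq_add_neg]; exact hζne
  obtain ⟨hLne, hΛ, hΛhalf⟩ := hLb (beta1 c' D) hβ1l (hβ1u.trans (by linarith))
  clear hLb
  have tΛ := norm_inv_sub_one_le hΛ hΛhalf
  have tΛ1 : 2 * (CL / ell D ^ 6) ≤ 1 := by linarith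
  have tω : ‖GaussWeight.omega1 (ell D ^ 30) (beta3 c' D - beta1 c' D) - 1‖ ≤ 32 / ell D ^ 30 :=
    norm_omega1_sub_one_le hL h31u
  have tω1 : 32 / ell D ^ 30 ≤ 1 := by
    rw [div_le_one (pow_pos hℓ 30)]
    have : (3 : ℝ) ^ 30 ≤ ell D ^ 30 := pow_le_pow_left₀ (by norm_num) hL 30
    nlinarith
  -- closed form and identity
  have hval := calR1_one_eq c' χ hχ1 hP h21ne h31ne hβ1ne hζne' hLne
  rw [add_sub_assoc] at hval
  have hid := residue_identity15 (ζu := riemannZeta (1 + (beta2 c' D - beta1 c' D)))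
    (P := ((P4 D : ℝ) : ℂ) ^ (beta3 c' D - beta1 c' D))
    (w := GaussWeight.omega1 (ell D ^ 30) (beta3 c' D - beta1 c' D))
    h21ne h31ne hL0 hζne' hLne hβ1ne
  rw [hval, hid, show (beta2 c' D - beta1 c' D) * (beta3 c' D - beta1 c' D) * L1 =
    (beta2 c' D - beta1 c' D) * (beta3 c' D - beta1 c' D) * L1 from rfl]
  refine norm_mul_sub_one_le_rel ?_
  -- the product of the four near-one factors, in the order `((Zu · Z₁⁻¹) · Λ⁻¹) · ω`
  have s1 := norm_mul_sub_one_le tZu (by rw [sub_eq_add_neg]; exact tZ1inv) tZ1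
  have s2 := norm_mul_sub_one_le s1 tΛ tΛ1
  have s3 := norm_mul_sub_one_le s2 tω tω1
  refine s3.trans ?_
  have p6 : (0 : ℝ) < ell D ^ 6 := pow_pos hℓ 6
  have i4 : 16 * K * π / ell D ^ 9 ≤ 16 * K * π / ell D ^ 6 :=
    div_le_div_of_nonneg_left (by positivity) p6 (pow_le_pow_right₀ hℓ1 (by norm_num))
  have i5 : 32 / ell D ^ 30 ≤ 32 / ell D ^ 6 :=
    div_le_div_of_nonneg_left (by positivity) p6 (pow_le_pow_right₀ hℓ1 (by norm_num))
  have eq : (4 * CL + 12 * (16 * K * π) + 32) / ell D ^ 6 =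
      2 * (2 * (CL / ell D ^ 6)) + 12 * (16 * K * π / ell D ^ 6) + 32 / ell D ^ 6 := by
    field_simp
    ring
  rw [eq]
  linarith only [i4, i5, hCL0, hK, Real.pi_pos]

/-- **`ℛ₁₂ = M₁₂(1 + O(𝓛⁻⁶))` under the minimum premise** (twin of `ResidueValues.calR1_two_rel`, same constant).
[cite: Zhang2022LandauSiegel, §15 p. 88] -/
theorem calR1_two_rel_pow15 : ∃ C : ℝ, 0 ≤ C ∧ ForAllLarge fun D _ χ => ‖χ.LFunction 1‖ ≤ 1 / Real.log D ^ 15 →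
    ‖calR1 c' χ 2 - ((P4 D : ℝ) : ℂ) ^ (beta3 c' D - beta2 c' D) /
        ((beta3 c' D - beta2 c' D) * (beta1 c' D - beta2 c' D) * deriv χ.LFunction 1)‖ ≤
      C / ell D ^ 6 * ‖((P4 D : ℝ) : ℂ) ^ (beta3 c' D - beta2 c' D) /
        ((beta3 c' D - beta2 c' D) * (beta1 c' D - beta2 c' D) * deriv χ.LFunction 1)‖ := by
  obtain ⟨K, hK, CL, hCL0, c, hc, D₀, hall⟩ := residue_setup_pow15 c'
  refine ⟨4 * CL + 12 * (16 * K * π) + 32, by positivity, D₀, fun D _ χ hD hq hp h15 => ?_⟩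
  obtain ⟨⟨hL, he, hKℓ, hχ1⟩, hcL, hζ, hLb⟩ := hall D χ hD hq hp h15
  clear hall
  have hℓ : 0 < ell D := by linarith
  have hℓ1 : 1 ≤ ell D := by linarith
  have hα := alpha_pos hL
  set L1 : ℂ := deriv χ.LFunction 1 with hL1
  have hN : 0 < ‖L1‖ := lt_of_lt_of_le hc hcL
  have hL0 : L1 ≠ 0 := fun h => by rw [h, norm_zero] at hN; exact lt_irrefl _ hN
  obtain ⟨-, hβ2l, -⟩ := norm_beta_ge c' hL he
  have hβ2u := norm_beta2_le c' hL he
  obtain ⟨⟨h21l, h21u⟩, -, ⟨h32l, h32u⟩⟩ := norm_beta_sub c' hL he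
  have hβ2ne : beta2 c' D ≠ 0 := fun h => by rw [h, norm_zero] at hβ2l; linarith
  have h12ne : beta1 c' D - beta2 c' D ≠ 0 := by
    intro h; apply (fun h' => by rw [h', norm_zero] at h21l; linarith : beta2 c' D - beta1 c' D ≠ 0)
    linear_combination -h
  have h12u : ‖beta1 c' D - beta2 c' D‖ ≤ 8 * alpha D := by rw [norm_sub_rev]; exact h21u
  have h32ne : beta3 c' D - beta2 c' D ≠ 0 := fun h => by rw [h, norm_zero] at h32l; linarith
  have hP := P4_pos hL
  obtain ⟨-, tZu, -, tZ1⟩ := zetaFactor_bounds hL hK hKℓ hζ h12ne h12u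
  have hu2 : ‖-beta2 c' D‖ ≤ 8 * alpha D := by rw [norm_neg]; linarith
  obtain ⟨hζne, -, tZ2inv, -⟩ := zetaFactor_bounds hL hK hKℓ hζ (neg_ne_zero.mpr hβ2ne) hu2
  clear hζ
  have hζne' : riemannZeta (1 - beta2 c' D) ≠ 0 := by rw [sub_eq_add_neg]; exact hζne
  obtain ⟨hLne, hΛ, hΛhalf⟩ := hLb (beta2 c' D) hβ2l hβ2u
  clear hLb
  have tΛ := norm_inv_sub_one_le hΛ hΛhalf
  have tΛ1 : 2 * (CL / ell D ^ 6) ≤ 1 := by linarith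
  have tω : ‖GaussWeight.omega1 (ell D ^ 30) (beta3 c' D - beta2 c' D) - 1‖ ≤ 32 / ell D ^ 30 :=
    norm_omega1_sub_one_le hL h32u
  have tω1 : 32 / ell D ^ 30 ≤ 1 := by
    rw [div_le_one (pow_pos hℓ 30)]
    have : (3 : ℝ) ^ 30 ≤ ell D ^ 30 := pow_le_pow_left₀ (by norm_num) hL 30
    nlinarith
  have hval := calR1_two_eq c' χ hχ1 hP h12ne h32ne hβ2ne hζne' hLne
  rw [add_sub_assoc] at hval
  -- reorder the printed denominator `(β₃−β₂)(β₁−β₂)` as `u·d = (β₁−β₂)(β₃−β₂)`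
  have hden : (beta3 c' D - beta2 c' D) * (beta1 c' D - beta2 c' D) * L1 =
      (beta1 c' D - beta2 c' D) * (beta3 c' D - beta2 c' D) * L1 := by ring
  have hid := residue_identity15 (ζu := riemannZeta (1 + (beta1 c' D - beta2 c' D)))
    (P := ((P4 D : ℝ) : ℂ) ^ (beta3 c' D - beta2 c' D))
    (w := GaussWeight.omega1 (ell D ^ 30) (beta3 c' D - beta2 c' D))
    h12ne h32ne hL0 hζne' hLne hβ2ne
  rw [hval, hden, hid]
  refine norm_mul_sub_one_le_rel ?_
  have s1 := norm_mul_sub_one_le tZu (by rw [sub_eq_add_neg]; exact tZ2inv) tZ1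
  have s2 := norm_mul_sub_one_le s1 tΛ tΛ1
  have s3 := norm_mul_sub_one_le s2 tω tω1
  refine s3.trans ?_
  have p6 : (0 : ℝ) < ell D ^ 6 := pow_pos hℓ 6
  have i4 : 16 * K * π / ell D ^ 9 ≤ 16 * K * π / ell D ^ 6 :=
    div_le_div_of_nonneg_left (by positivity) p6 (pow_le_pow_right₀ hℓ1 (by norm_num))
  have i5 : 32 / ell D ^ 30 ≤ 32 / ell D ^ 6 :=
    div_le_div_of_nonneg_left (by positivity) p6 (pow_le_pow_right₀ hℓ1 (by norm_num))
  have eq : (4 * CL + 12 * (16 * K * π) + 32) / ell D ^ 6 =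
      2 * (2 * (CL / ell D ^ 6)) + 12 * (16 * K * π / ell D ^ 6) + 32 / ell D ^ 6 := by
    field_simp
    ring
  rw [eq]
  linarith only [i4, i5, hCL0, hK, Real.pi_pos]

/-- **`ℛ₁₃ = M₁₃(1 + O(𝓛⁻⁶))` under the minimum premise** (twin of `ResidueValues.calR1_three_rel`, same constant).
[cite: Zhang2022LandauSiegel, §15 p. 88] -/
theorem calR1_three_rel_pow15 : ∃ C : ℝ, 0 ≤ C ∧ ForAllLarge fun D _ χ => ‖χ.LFunction 1‖ ≤ 1 / Real.log D ^ 15 →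
    ‖calR1 c' χ 3 - ((P4 D : ℝ) : ℂ) ^ (beta3 c' D - beta3 c' D) /
        ((beta1 c' D - beta3 c' D) * (beta2 c' D - beta3 c' D) * deriv χ.LFunction 1)‖ ≤
      C / ell D ^ 6 * ‖((P4 D : ℝ) : ℂ) ^ (beta3 c' D - beta3 c' D) /
        ((beta1 c' D - beta3 c' D) * (beta2 c' D - beta3 c' D) * deriv χ.LFunction 1)‖ := by
  obtain ⟨K, hK, CL, hCL0, c, hc, D₀, hall⟩ := residue_setup_pow15 c'
  refine ⟨4 * CL + 28 * (16 * K * π) + 32, by positivity, D₀, fun D _ χ hD hq hp h15 => ?_⟩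
  obtain ⟨⟨hL, he, hKℓ, hχ1⟩, hcL, hζ, hLb⟩ := hall D χ hD hq hp h15
  clear hall
  have hℓ : 0 < ell D := by linarith
  have hℓ1 : 1 ≤ ell D := by linarith
  have hα := alpha_pos hL
  set L1 : ℂ := deriv χ.LFunction 1 with hL1
  have hN : 0 < ‖L1‖ := lt_of_lt_of_le hc hcL
  have hL0 : L1 ≠ 0 := fun h => by rw [h, norm_zero] at hN; exact lt_irrefl _ hN
  obtain ⟨-, -, hβ3l⟩ := norm_beta_ge c' hL he
  have hβ3u := norm_beta3_le c' hL he
  obtain ⟨-, ⟨h31l, h31u⟩, ⟨h32l, h32u⟩⟩ := norm_beta_sub c' hL he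
  have hβ3ne : beta3 c' D ≠ 0 := fun h => by rw [h, norm_zero] at hβ3l; linarith
  have h13ne : beta1 c' D - beta3 c' D ≠ 0 := by
    intro h; apply (fun h' => by rw [h', norm_zero] at h31l; linarith : beta3 c' D - beta1 c' D ≠ 0)
    linear_combination -h
  have h23ne : beta2 c' D - beta3 c' D ≠ 0 := by
    intro h; apply (fun h' => by rw [h', norm_zero] at h32l; linarith : beta3 c' D - beta2 c' D ≠ 0)
    linear_combination -h
  have h13u : ‖beta1 c' D - beta3 c' D‖ ≤ 8 * alpha D := by rw [norm_sub_rev]; exact h31u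
  have h23u : ‖beta2 c' D - beta3 c' D‖ ≤ 8 * alpha D := by rw [norm_sub_rev]; exact h32u
  have hP := P4_pos hL
  obtain ⟨-, tZu1, -, tZ1⟩ := zetaFactor_bounds hL hK hKℓ hζ h13ne h13u
  obtain ⟨-, tZu2, -, -⟩ := zetaFactor_bounds hL hK hKℓ hζ h23ne h23u
  have hu3 : ‖-beta3 c' D‖ ≤ 8 * alpha D := by rw [norm_neg]; linarith
  obtain ⟨hζne, -, tZ3inv, -⟩ := zetaFactor_bounds hL hK hKℓ hζ (neg_ne_zero.mpr hβ3ne) hu3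
  clear hζ
  have hζne' : riemannZeta (1 - beta3 c' D) ≠ 0 := by rw [sub_eq_add_neg]; exact hζne
  obtain ⟨hLne, hΛ, hΛhalf⟩ := hLb (beta3 c' D) hβ3l hβ3u
  clear hLb
  have tΛ := norm_inv_sub_one_le hΛ hΛhalf
  have tΛ1 : 2 * (CL / ell D ^ 6) ≤ 1 := by linarith
  have h33u : ‖beta3 c' D - beta3 c' D‖ ≤ 8 * alpha D := by rw [sub_self, norm_zero]; positivity
  have tω : ‖GaussWeight.omega1 (ell D ^ 30) (beta3 c' D - beta3 c' D) - 1‖ ≤ 32 / ell D ^ 30 :=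
    norm_omega1_sub_one_le hL h33u
  have tω1 : 32 / ell D ^ 30 ≤ 1 := by
    rw [div_le_one (pow_pos hℓ 30)]
    have : (3 : ℝ) ^ 30 ≤ ell D ^ 30 := pow_le_pow_left₀ (by norm_num) hL 30
    nlinarith
  have hval := calR1_three_eq c' χ hχ1 hP h13ne h23ne hβ3ne hζne' hLne
  rw [add_sub_assoc, add_sub_assoc] at hval
  have hid := residue_identity15_three (ζ₁ := riemannZeta (1 + (beta1 c' D - beta3 c' D)))
    (ζ₂ := riemannZeta (1 + (beta2 c' D - beta3 c' D)))
    (P := ((P4 D : ℝ) : ℂ) ^ (beta3 c' D - beta3 c' D))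
    (w := GaussWeight.omega1 (ell D ^ 30) (beta3 c' D - beta3 c' D))
    h13ne h23ne hL0 hζne' hLne hβ3ne
  rw [hval, hid]
  refine norm_mul_sub_one_le_rel ?_
  have s1 := norm_mul_sub_one_le tZu1 tZu2 tZ1
  have s2 := norm_mul_sub_one_le s1 (by rw [sub_eq_add_neg]; exact tZ3inv) tZ1
  have s3 := norm_mul_sub_one_le s2 tΛ tΛ1
  have s4 := norm_mul_sub_one_le s3 tω tω1
  refine s4.trans ?_
  have p6 : (0 : ℝ) < ell D ^ 6 := pow_pos hℓ 6
  have i4 : 16 * K * π / ell D ^ 9 ≤ 16 * K * π / ell D ^ 6 :=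
    div_le_div_of_nonneg_left (by positivity) p6 (pow_le_pow_right₀ hℓ1 (by norm_num))
  have i5 : 32 / ell D ^ 30 ≤ 32 / ell D ^ 6 :=
    div_le_div_of_nonneg_left (by positivity) p6 (pow_le_pow_right₀ hℓ1 (by norm_num))
  have i6 : CL / ell D ^ 6 ≤ CL / ell D ^ 6 := le_rfl
  have eq : (4 * CL + 28 * (16 * K * π) + 32) / ell D ^ 6 =
      2 * (2 * (CL / ell D ^ 6)) + 28 * (16 * K * π / ell D ^ 6) + 32 / ell D ^ 6 := by
    field_simp
    ring
  rw [eq]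
  linarith only [i4, i5, hCL0, hK, Real.pi_pos]

end Literature.NumberTheory.LFunctions.Zhang2022.ResidueValues
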